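import Mathlib.LinearAlgebra.Quotient.Basic
import Mathlib.LinearAlgebra.Dimension.Constructions
import Mathlib.LinearAlgebra.FiniteDimensional.Lemmas
import Mathlib.Data.Matrix.Mul
import Literature.Computability.MetaComplexity.AffineClauseSystems
import Literature.Combinatorics.Matroid.RadoIndependentTransversal
import HarnessLib

/-!
# The closure of a linear system with respect to a block structure (Efremenko–Garlík–Itsykson)

Setting: an affine (linear) system `Ψ` over `𝔽₂` on a finite variable set `V`
(`Literature.Computability.MetaComplexity.AffSys`), and a BLOCK STRUCTURE on `V`: pairwise distinct
variables `b e i` (`e : E` the blocks, `i : Fin ℓ` the positions inside a block; the remaining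
variables of `V` are "free-standing"). This is the situation of a linear system on the variables of
a LIFTED formula `φ ∘ g` (one block of `ℓ` fresh variables per original variable, Alekseev–Itsykson,
Bhattacharya–Byramji–Chattopadhyay–Impagliazzo) or of the binary pigeonhole principle (one block per
pigeon, Efremenko–Garlík–Itsykson).

**The closure lemma** (`AffSys.exists_closure`). For every system `Ψ` there are a set of
blocks `Q₀` — a CLOSURE — with

* `Q₀ = ∅` or `|Q₀| + 1 ≤ rk Ψ` (`rk Ψ = dim ⟨L(Ψ)⟩`), and
* a choice of one PIVOT position `p e` in every block,

such that for every solution `α` of `Ψ` and every family of target values `t e i` there is a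
solution `β` of `Ψ` which AGREES WITH `α` on every variable outside the blocks not in `Q₀` (so on the
blocks of `Q₀` and on the free-standing variables) and takes the value `t e i` at every non-pivot
position `i ≠ p e` of every block `e ∉ Q₀`. In words: after freezing the closure, all but one
variable of every other block are jointly free. With a 1-stifling gadget `g` (e.g. `MAJ₃`, `ℓ = 3`:
two equal inputs force the output) this makes the gadget values of all blocks outside the closure
simultaneously and arbitrarily settable — Lemma 4.5 of Bhattacharya et al.

This is the linear-algebraic core ("safe sets of linear forms", "closure") of Efremenko–Garlík–
Itsykson, STOC 2024, §3–§4: Thm 3.1 (a set of `k` independent forms is safe iff its coefficient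
matrix has `k` independent columns in `k` distinct blocks — Welsh's extension of Hall's theorem,
i.e. Rado's theorem), the closure `Cl(F)` (§4, Algorithm 4.1, uniqueness Lemma 4.4, size bound
Lemma 4.7 `|Cl(F)| ≤ rk`), and its use in Bhattacharya–Byramji–Chattopadhyay–Impagliazzo, STOC 2026,
§3.1 and Lemma 4.5 (outside `Cl(Φ)`, fix all bits of a block but the pivot "according to a stifling
assignment to force the output"). The proof here is a compact variant: the closure is taken to be
a MAXIMISER `Q₀` of the deficiency `Q ↦ dim(⟨L(Ψ)⟩ ∩ 𝔽₂^{V ∖ U(E ∖ Q)}) - |Q|` (with `Q₀ = ∅` when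
the maximum is `0`; the positive deficiency otherwise gives the `+ 1` in the size bound for free),
maximality says that in the quotient matroid `𝔽₂^V / (⟨L(Ψ)⟩ + 𝔽₂^Z)` (`Z` = the frozen
variables) every union of `m` outside blocks has rank `≥ (ℓ - 1) m`, Rado's theorem
(`Literature.Combinatorics.Matroid.rado_vector_space`, applied to the outside blocks each repeated
`ℓ - 1` times) picks `ℓ - 1` positions per outside block whose unit vectors are jointly independent
modulo `⟨L(Ψ)⟩ + 𝔽₂^Z`, and the one-step extension lemma of `AffSys` prescribes their values. No
uniqueness / minimality of the closure is needed or claimed.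

The file is definition-free (the closure and the pivots are produced existentially).

## References

* K. Efremenko, M. Garlík, D. Itsykson, *Lower bounds for regular resolution over parities*,
  STOC 2024 (SIAM J. Comput. 2025), §3 (safe and dangerous sets, Thm 3.1, Thm 3.2–3.3 = Welsh 1971),
  §4 (closure: Algorithm 4.1, Lemma 4.4, Lemma 4.7, Lemma 4.9).
* S. K. Bhattacharya, F. Byramji, A. Chattopadhyay, R. Impagliazzo, *Lower bounds for
  near-quadratic-depth resolution over parities*, STOC 2026, §3.1 (safe collections and closure,
  `|Cl(Φ)| ≤ rk(Φ)`), Lemma 4.4–4.5 (stifling assignments outside the closure).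
* D. Itsykson, V. Podolskii, A. Shekhovtsov, *Resolution width lifts to near-quadratic-depth
  Res(⊕) size*, CCC 2026, §2.4 (Defs 2.13–2.19: safe, deviolator, closure, closure assignment).
* R. Rado, *A theorem on independence relations*, Quart. J. Math. 13 (1942), Thm 1; D. J. A. Welsh,
  *Matroid Theory* (1976), Ch. 7.
-/

namespace Literature.Computability.MetaComplexity

namespace AffSys

open Finset Submodule Module

variable {V : Type*} [Fintype V] [DecidableEq V]

/-! ### Prescribing the values of independent coordinates -/

/-- PRESCRIPTION LEMMA: if the unit vectors `e_{u j}` (`j : ι`) are linearly independent modulo the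
form span `⟨L(Ψ)⟩` of a consistent system `Ψ`, then `Ψ` has a solution taking arbitrary prescribed
values `t j` at the coordinates `u j` (iterated one-step extension,
`AffSys.extend_consistent`). [Efremenko–Garlík–Itsykson 2024, §3 (remark after Thm 3.1: "we can
assign values to all variables except the chosen `k` … arbitrarily")]
[cite: EfremenkoGarlikItsykson2024, Thm 3.1] -/
theorem exists_sol_prescribe {Ψ : AffSys V} (hcons : (Sol Ψ).Nonempty)
    {ι : Type*} [Fintype ι] [DecidableEq ι] (u : ι → V) (t : ι → ZMod 2)
    (hli : LinearIndependent (ZMod 2)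
      (fun j => (spanS Ψ).mkQ (Pi.single (u j) (1 : ZMod 2)))) :
    ∃ z ∈ Sol Ψ, ∀ j, z (u j) = t j := by
  classical
  -- the systems `Ψ ∪ {x_{u j} = t j : j ∈ s}` are consistent, by induction on `s`
  have main : ∀ s : Finset ι,
      (Sol (Ψ ∪ s.image (fun j => (Pi.single (u j) (1 : ZMod 2), t j)))).Nonempty ∧
      spanS (Ψ ∪ s.image (fun j => (Pi.single (u j) (1 : ZMod 2), t j))) =
        spanS Ψ ⊔ Submodule.span (ZMod 2)
          ((s.image fun j => (Pi.single (u j) (1 : ZMod 2) : V → ZMod 2) :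
              Finset (V → ZMod 2)) : Set (V → ZMod 2)) := by
    intro s
    induction s using Finset.induction_on with
    | empty =>
      refine ⟨by simpa using hcons, ?_⟩
      rw [Finset.image_empty, Finset.union_empty, Finset.image_empty]
      simp
    | insert j s hjs ih =>
      obtain ⟨ihcons, ihspan⟩ := ih
      have hsplit : Ψ ∪ (insert j s).image (fun j => (Pi.single (u j) (1 : ZMod 2), t j)) =
          (Ψ ∪ s.image (fun j => (Pi.single (u j) (1 : ZMod 2), t j))) ∪
            {(Pi.single (u j) (1 : ZMod 2), t j)} := by
        rw [Finset.image_insert, Finset.union_insert, Finset.insert_eq, Finset.union_comm]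
      -- the new unit vector is outside the current form span
      have hnot : (Pi.single (u j) (1 : ZMod 2) : V → ZMod 2) ∉
          spanS (Ψ ∪ s.image (fun j => (Pi.single (u j) (1 : ZMod 2), t j))) := by
        rw [ihspan]
        intro hmem
        -- push to the quotient by `⟨L(Ψ)⟩`
        have h1 : (spanS Ψ).mkQ (Pi.single (u j) 1) ∈
            Submodule.map (spanS Ψ).mkQ
              (spanS Ψ ⊔ Submodule.span (ZMod 2)
                ((s.image fun j => (Pi.single (u j) (1 : ZMod 2) : V → ZMod 2) :
                    Finset (V → ZMod 2)) : Set (V → ZMod 2))) :=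
          Submodule.mem_map_of_mem hmem
        rw [Submodule.map_sup, Submodule.map_span] at h1
        have hbot : Submodule.map (spanS Ψ).mkQ (spanS Ψ) = ⊥ := by
          rw [Submodule.eq_bot_iff]
          intro q hq
          obtain ⟨v, hv, rfl⟩ := Submodule.mem_map.mp hq
          exact (Submodule.Quotient.mk_eq_zero _).mpr hv
        rw [hbot, bot_sup_eq] at h1
        have himg : ((spanS Ψ).mkQ ''
            ((s.image fun j => (Pi.single (u j) (1 : ZMod 2) : V → ZMod 2) :
                Finset (V → ZMod 2)) : Set (V → ZMod 2))) =
            (fun j => (spanS Ψ).mkQ (Pi.single (u j) (1 : ZMod 2))) '' (s : Set ι) := by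
          ext q
          simp only [Set.mem_image, Finset.mem_coe, Finset.mem_image]
          constructor
          · rintro ⟨v, ⟨i, hi, rfl⟩, rfl⟩
            exact ⟨i, hi, rfl⟩
          · rintro ⟨i, hi, rfl⟩
            exact ⟨_, ⟨i, hi, rfl⟩, rfl⟩
        rw [himg] at h1
        exact hli.notMem_span_image (s := (s : Set ι)) (by simpa using hjs) h1
      refine ⟨?_, ?_⟩
      · rw [hsplit]
        exact extend_consistent ihcons hnot (t j)
      · rw [hsplit, spanS_union, ihspan, Finset.image_insert, Finset.coe_insert,
          Submodule.span_insert, sup_assoc]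
        congr 1
        rw [sup_comm]
        unfold spanS forms
        rw [Finset.image_singleton, Finset.coe_singleton]
  obtain ⟨z, hz⟩ := (main Finset.univ).1
  rw [Sol_union] at hz
  refine ⟨z, hz.1, fun j => ?_⟩
  have := hz.2 (Pi.single (u j) (1 : ZMod 2), t j)
    (Finset.mem_image.mpr ⟨j, Finset.mem_univ j, rfl⟩)
  simpa [single_dotProduct] using this

/-- Linear independence modulo a submodule is invariant under rewriting the submodule. [folklore] -/
theorem linearIndependent_mkQ_congr {M : Type*} [AddCommGroup M] [Module (ZMod 2) M]
    {p q : Submodule (ZMod 2) M} (h : p = q) {ι : Type*} (f : ι → M)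
    (hli : LinearIndependent (ZMod 2) (fun j => p.mkQ (f j))) :
    LinearIndependent (ZMod 2) (fun j => q.mkQ (f j)) := by
  subst h
  exact hli

/-! ### The closure lemma -/

/-- **The closure lemma** (Efremenko–Garlík–Itsykson closure of a linear system with respect to a
block structure, with the stifling-assignment consequence of Bhattacharya et al.). Let `Ψ` be an
affine system over `𝔽₂` on `V`, and let `b e i` (`e : E`, `i : Fin ℓ`, `ℓ ≥ 1`) be pairwise
distinct variables (the blocks). Then there are a set of blocks `Q₀` with `Q₀ = ∅` or
`|Q₀| + 1 ≤ dim ⟨L(Ψ)⟩`, and pivot positions `p e`, such that: for every solution `α` of `Ψ` and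
all targets `t e i` there is a solution `β` of `Ψ` that agrees with `α` on every variable which is
not in a block outside `Q₀`, and has `β (b e i) = t e i` for every block `e ∉ Q₀` and every position
`i ≠ p e`. [Efremenko–Garlík–Itsykson 2024, Thm 3.1 and §4 (closure, Lemma 4.7);
Bhattacharya–Byramji–Chattopadhyay–Impagliazzo 2026, §3.1 and Lemma 4.5]
[cite: EfremenkoGarlikItsykson2024, Thm 3.1] -/
theorem exists_closure {E : Type*} [Fintype E] [DecidableEq E] {ℓ : ℕ} (hℓ : 0 < ℓ)
    (b : E → Fin ℓ → V) (hb : ∀ e e' i i', b e i = b e' i' → e = e' ∧ i = i')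
    (Ψ : AffSys V) :
    ∃ Q₀ : Finset E, (Q₀ = ∅ ∨ Q₀.card + 1 ≤ finrank (ZMod 2) (spanS Ψ)) ∧
      ∃ p : E → Fin ℓ, ∀ α ∈ Sol Ψ, ∀ t : E → Fin ℓ → ZMod 2, ∃ β ∈ Sol Ψ,
        (∀ v, (∀ e, e ∉ Q₀ → ∀ i, b e i ≠ v) → β v = α v) ∧
        (∀ e, e ∉ Q₀ → ∀ i, i ≠ p e → β (b e i) = t e i) := by
  classical
  -- notation
  set S : Submodule (ZMod 2) (V → ZMod 2) := spanS Ψ with hSdef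
  set k : ℕ := finrank (ZMod 2) S with hkdef
  -- the variables of a set of blocks, and the variables NOT in the blocks outside `Q`
  let U : Finset E → Finset V := fun Q => Q.biUnion fun e => Finset.univ.image (b e)
  let Zf : Finset E → Finset V := fun Q => Finset.univ \ U (Finset.univ \ Q)
  -- the deficiency of a set of blocks
  let f : Finset E → ℤ := fun Q =>
    (finrank (ZMod 2) (S ⊓ coordS (Zf Q) : Submodule (ZMod 2) (V → ZMod 2)) : ℤ) - (Q.card : ℤ)
  -- basic facts on the block structure
  have hmemU : ∀ (Q : Finset E) (v : V), v ∈ U Q ↔ ∃ e ∈ Q, ∃ i, b e i = v := by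
    intro Q v
    simp only [U, Finset.mem_biUnion, Finset.mem_image, Finset.mem_univ, true_and]
  have hcardU : ∀ Q : Finset E, (U Q).card = ℓ * Q.card := by
    intro Q
    rw [Finset.card_biUnion]
    · have : ∀ e ∈ Q, (Finset.univ.image (b e)).card = ℓ := by
        intro e _
        rw [Finset.card_image_of_injective _ (fun i i' h => (hb e e i i' h).2), Finset.card_univ,
          Fintype.card_fin]
      rw [Finset.sum_congr rfl this, Finset.sum_const, smul_eq_mul, mul_comm]
    · intro e _ e' _ hne
      rw [Function.onFun, Finset.disjoint_left]
      intro v hv hv'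
      rw [Finset.mem_image] at hv hv'
      obtain ⟨i, -, rfl⟩ := hv
      obtain ⟨i', -, h⟩ := hv'
      exact hne (hb e' e i' i h).1.symm
  -- ### Step 1: the closure `Q₀` maximises the deficiency (and is `∅` if the maximum is `0`)
  obtain ⟨Q₁, -, hQ₁⟩ :=
    Finset.exists_max_image (Finset.univ : Finset (Finset E)) f Finset.univ_nonempty
  have hf0 : 0 ≤ f ∅ := by
    show (0 : ℤ) ≤ _ - ((∅ : Finset E).card : ℤ)
    rw [Finset.card_empty]
    simp
  obtain ⟨Q₀, hmax, hpos⟩ : ∃ Q₀ : Finset E, (∀ Q, f Q ≤ f Q₀) ∧ (Q₀ = ∅ ∨ 1 ≤ f Q₀) := by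
    by_cases h1 : 1 ≤ f Q₁
    · exact ⟨Q₁, fun Q => hQ₁ Q (Finset.mem_univ Q), Or.inr h1⟩
    · refine ⟨∅, fun Q => ?_, Or.inl rfl⟩
      have := hQ₁ Q (Finset.mem_univ Q)
      have hQe := hQ₁ ∅ (Finset.mem_univ _)
      omega
  have hrk_le : finrank (ZMod 2) (S ⊓ coordS (Zf Q₀) : Submodule (ZMod 2) (V → ZMod 2)) ≤ k :=
    Submodule.finrank_mono inf_le_left
  refine ⟨Q₀, ?_, ?_⟩
  · rcases hpos with h | h
    · exact Or.inl h
    · right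
      have : (1 : ℤ) ≤ _ - (Q₀.card : ℤ) := h
      omega
  -- ### Step 2: the outside blocks `O`, the frozen variables `Z`, the modulus `S₁ = S + 𝔽₂^Z`
  set O : Finset E := Finset.univ \ Q₀ with hOdef
  set Z : Finset V := Zf Q₀ with hZdef
  have hZ : Z = Finset.univ \ U O := rfl
  set S₁ : Submodule (ZMod 2) (V → ZMod 2) := S ⊔ coordS Z with hS₁def
  -- KEY INEQUALITY (maximality): `dim (S₁ ∩ 𝔽₂^{U s}) ≤ |s|` for every set `s` of outside blocks
  have hkey : ∀ s : Finset E, s ⊆ O →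
      finrank (ZMod 2) (S₁ ⊓ coordS (U s) : Submodule (ZMod 2) (V → ZMod 2)) ≤ s.card := by
    intro s hs
    -- `Zf (Q₀ ∪ s) = Z ∪ U s`, disjointly
    have hdisjZU : Disjoint Z (U s) := by
      rw [hZ, Finset.disjoint_left]
      intro v hv hvs
      rw [Finset.mem_sdiff] at hv
      apply hv.2
      rw [hmemU] at hvs ⊢
      obtain ⟨e, he, i, rfl⟩ := hvs
      exact ⟨e, hs he, i, rfl⟩
    have hZ' : Zf (Q₀ ∪ s) = Z ∪ U s := by
      ext v
      rw [hZ, Finset.mem_union, Finset.mem_sdiff, Finset.mem_sdiff]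
      simp only [Finset.mem_univ, true_and]
      rw [hmemU, hmemU, hmemU]
      constructor
      · intro h
        by_cases hvs : ∃ e ∈ s, ∃ i, b e i = v
        · exact Or.inr hvs
        · refine Or.inl ?_
          rintro ⟨e, he, i, hbe⟩
          have hes : e ∉ s := fun hes => hvs ⟨e, hes, i, hbe⟩
          rw [hOdef, Finset.mem_sdiff] at he
          refine h ⟨e, Finset.mem_sdiff.mpr ⟨Finset.mem_univ _, ?_⟩, i, hbe⟩
          rw [Finset.mem_union]
          rintro (h1 | h1)
          exacts [he.2 h1, hes h1]
      · rintro (h | ⟨e, he, i, rfl⟩)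
        · rintro ⟨e, he, i, hbe⟩
          rw [Finset.mem_sdiff, Finset.mem_union, not_or] at he
          refine h ⟨e, ?_, i, hbe⟩
          rw [hOdef, Finset.mem_sdiff]
          exact ⟨Finset.mem_univ _, he.2.1⟩
        · rintro ⟨e', he', i', hbe⟩
          obtain ⟨rfl, rfl⟩ := hb e' e i' i hbe
          rw [Finset.mem_sdiff, Finset.mem_union, not_or] at he'
          exact he'.2.2 he
    -- dimension bookkeeping
    have h1 := Submodule.finrank_sup_add_finrank_inf_eq S (coordS Z)
    rw [← hS₁def] at h1
    have h2 := Submodule.finrank_sup_add_finrank_inf_eq S (coordS (Z ∪ U s))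
    have h3 := Submodule.finrank_sup_add_finrank_inf_eq S₁ (coordS (U s))
    have h4 : S₁ ⊔ coordS (U s) = S ⊔ coordS (Z ∪ U s) := by
      rw [hS₁def, coordS_union, sup_assoc]
    have h4' : finrank (ZMod 2) (S₁ ⊔ coordS (U s) : Submodule (ZMod 2) (V → ZMod 2)) =
        finrank (ZMod 2) (S ⊔ coordS (Z ∪ U s) : Submodule (ZMod 2) (V → ZMod 2)) := by
      rw [h4]
    have h5 : (Z ∪ U s).card = Z.card + (U s).card := Finset.card_union_of_disjoint hdisjZU
    rw [finrank_coordS] at h1 h2 h3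
    -- maximality of `Q₀`
    have hm := hmax (Q₀ ∪ s)
    have hdisjQ : Disjoint Q₀ s := by
      rw [Finset.disjoint_left]
      intro e he hes
      have := hs hes
      rw [hOdef, Finset.mem_sdiff] at this
      exact this.2 he
    have hcardQ : (Q₀ ∪ s).card = Q₀.card + s.card := Finset.card_union_of_disjoint hdisjQ
    simp only [f] at hm
    rw [hZ', hcardQ] at hm
    change (finrank (ZMod 2) (S ⊓ coordS (Z ∪ U s) : Submodule (ZMod 2) (V → ZMod 2)) : ℤ) -
        _ ≤ (finrank (ZMod 2) (S ⊓ coordS Z : Submodule (ZMod 2) (V → ZMod 2)) : ℤ) - _ at hm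
    push_cast at hm
    omega
  -- ### Step 3: Rado's theorem in `𝔽₂^V / S₁`, every outside block repeated `ℓ - 1` times
  let ι : Type _ := ↥O × Fin (ℓ - 1)
  let Afam : ι → Finset ((V → ZMod 2) ⧸ S₁) := fun x =>
    (Finset.univ : Finset (Fin ℓ)).image fun i => S₁.mkQ (Pi.single (b x.1.1 i) (1 : ZMod 2))
  have hadm : ∀ sf : Finset ι,
      sf.card ≤ finrank (ZMod 2)
        (Submodule.span (ZMod 2)
          ((sf.biUnion Afam : Finset ((V → ZMod 2) ⧸ S₁)) : Set ((V → ZMod 2) ⧸ S₁))) := by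
    intro sf
    -- the blocks used by `sf`
    set sE : Finset E := (sf.image Prod.fst).image Subtype.val with hsE
    have hsEO : sE ⊆ O := by
      intro e he
      rw [hsE, Finset.mem_image] at he
      obtain ⟨e', _, rfl⟩ := he
      exact e'.2
    -- `|sf| ≤ (ℓ - 1) |sE|`
    have hcard_sf : sf.card ≤ (ℓ - 1) * sE.card := by
      have hsub : sf ⊆ (sf.image Prod.fst) ×ˢ (Finset.univ : Finset (Fin (ℓ - 1))) := by
        intro x hx
        rw [Finset.mem_product]
        exact ⟨Finset.mem_image_of_mem _ hx, Finset.mem_univ _⟩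
      have h1 := Finset.card_le_card hsub
      rw [Finset.card_product, Finset.card_univ, Fintype.card_fin] at h1
      have h2 : (sf.image Prod.fst).card = sE.card := by
        rw [hsE, Finset.card_image_of_injective _ Subtype.val_injective]
      rw [h2] at h1
      linarith [Nat.mul_comm (sE.card) (ℓ - 1)]
    -- the span of the used unit vectors is `𝔽₂^{U sE} mod S₁`
    have hspan : (coordS (U sE)).map S₁.mkQ ≤ Submodule.span (ZMod 2)
        ((sf.biUnion Afam : Finset ((V → ZMod 2) ⧸ S₁)) : Set ((V → ZMod 2) ⧸ S₁)) := by
      rw [Submodule.map_le_iff_le_comap]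
      rw [← span_singles, Submodule.span_le]
      intro v hv
      rw [Finset.coe_image, Set.mem_image] at hv
      obtain ⟨w, hw, rfl⟩ := hv
      rw [Finset.mem_coe, hmemU] at hw
      obtain ⟨e, he, i, rfl⟩ := hw
      rw [hsE, Finset.mem_image] at he
      obtain ⟨e', he', rfl⟩ := he
      rw [Finset.mem_image] at he'
      obtain ⟨x, hx, rfl⟩ := he'
      rw [SetLike.mem_coe, Submodule.mem_comap]
      apply Submodule.subset_span
      rw [Finset.mem_coe, Finset.mem_biUnion]
      refine ⟨x, hx, ?_⟩
      simp only [Afam, Finset.mem_image, Finset.mem_univ, true_and]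
      exact ⟨i, rfl⟩
    -- rank–nullity for the quotient map: `dim (𝔽₂^A mod S₁) + dim (S₁ ∩ 𝔽₂^A) = |A|`
    have hrn : finrank (ZMod 2) ((coordS (U sE)).map S₁.mkQ) +
        finrank (ZMod 2) (S₁ ⊓ coordS (U sE) : Submodule (ZMod 2) (V → ZMod 2)) =
          (U sE).card := by
      have h := LinearMap.finrank_range_add_finrank_ker (S₁.mkQ.comp (coordS (U sE)).subtype)
      rw [LinearMap.range_comp, Submodule.range_subtype, LinearMap.ker_comp,
        Submodule.ker_mkQ] at h
      have hker : finrank (ZMod 2) (Submodule.comap (coordS (U sE)).subtype S₁) =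
          finrank (ZMod 2) (S₁ ⊓ coordS (U sE) : Submodule (ZMod 2) (V → ZMod 2)) := by
        have heq : Submodule.comap (coordS (U sE)).subtype S₁ =
            Submodule.comap (coordS (U sE)).subtype (S₁ ⊓ coordS (U sE)) := by
          ext x
          simp only [Submodule.mem_comap, Submodule.mem_inf]
          exact ⟨fun hx => ⟨hx, x.2⟩, fun hx => hx.1⟩
        rw [heq, (Submodule.comapSubtypeEquivOfLe
          (inf_le_right : S₁ ⊓ coordS (U sE) ≤ coordS (U sE))).finrank_eq]
      rw [hker, finrank_coordS] at h
      exact h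
    have hk' := hkey sE hsEO
    have hmono := Submodule.finrank_mono hspan
    rw [hcardU] at hrn
    -- `|sf| ≤ (ℓ-1)|sE| ≤ ℓ|sE| - dim(S₁ ∩ 𝔽₂^{U sE}) = dim(𝔽₂^{U sE} mod S₁) ≤ dim span`
    have : (ℓ - 1) * sE.card + sE.card = ℓ * sE.card := by
      rcases Nat.exists_eq_succ_of_ne_zero (Nat.pos_iff_ne_zero.mp hℓ) with ⟨m, rfl⟩
      simp [Nat.succ_mul]
    omega
  obtain ⟨e', he', hli⟩ := Literature.Combinatorics.Matroid.rado_vector_space Afam hadm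
  -- the chosen positions
  have hidx : ∀ x : ι, ∃ i : Fin ℓ, S₁.mkQ (Pi.single (b x.1.1 i) (1 : ZMod 2)) = e' x := by
    intro x
    have := he' x
    simp only [Afam, Finset.mem_image, Finset.mem_univ, true_and] at this
    exact this
  choose idx hidx using hidx
  let g : ι → V := fun x => b x.1.1 (idx x)
  have hli' : LinearIndependent (ZMod 2) (fun x => S₁.mkQ (Pi.single (g x) (1 : ZMod 2))) := by
    have : (fun x => S₁.mkQ (Pi.single (g x) (1 : ZMod 2))) = e' := funext hidx
    rw [this]
    exact hli
  -- distinct indices get distinct positions (inside a block)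
  have hinj_idx : ∀ (e : ↥O) (j j' : Fin (ℓ - 1)), idx (e, j) = idx (e, j') → j = j' := by
    intro e j j' h
    have hinj := hli'.injective
    have : (fun x => S₁.mkQ (Pi.single (g x) (1 : ZMod 2))) (e, j) =
        (fun x => S₁.mkQ (Pi.single (g x) (1 : ZMod 2))) (e, j') := by
      simp only [g, h]
    exact (Prod.mk.inj (hinj this)).2
  -- the pivot of an outside block: a position not chosen
  have hpiv : ∀ e : ↥O, ∃ i : Fin ℓ, i ∉ (Finset.univ : Finset (Fin (ℓ - 1))).image (fun j => idx (e, j)) := by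
    intro e
    have hlt : ((Finset.univ : Finset (Fin (ℓ - 1))).image (fun j => idx (e, j))).card <
        (Finset.univ : Finset (Fin ℓ)).card := by
      rw [Finset.card_image_of_injective _ (fun j j' h => hinj_idx e j j' h), Finset.card_univ,
        Finset.card_univ, Fintype.card_fin, Fintype.card_fin]
      omega
    obtain ⟨i, -, hi⟩ := Finset.exists_mem_notMem_of_card_lt_card hlt
    exact ⟨i, hi⟩
  choose piv hpiv using hpiv
  let p : E → Fin ℓ := fun e => if h : e ∈ O then piv ⟨e, h⟩ else ⟨0, hℓ⟩
  -- every non-pivot position of an outside block is chosen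
  have hcover : ∀ (e : E) (he : e ∈ O) (i : Fin ℓ), i ≠ p e → ∃ j, idx (⟨e, he⟩, j) = i := by
    intro e he i hi
    have hp : p e = piv ⟨e, he⟩ := by simp [p, he]
    set img := (Finset.univ : Finset (Fin (ℓ - 1))).image (fun j => idx (⟨e, he⟩, j)) with himg
    have hcard : (insert (piv ⟨e, he⟩) img).card = (Finset.univ : Finset (Fin ℓ)).card := by
      rw [himg, Finset.card_insert_of_notMem (hpiv ⟨e, he⟩),
        Finset.card_image_of_injective _ (fun j j' h => hinj_idx _ j j' h), Finset.card_univ,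
        Finset.card_univ, Fintype.card_fin, Fintype.card_fin]
      omega
    have huniv : insert (piv ⟨e, he⟩) img = Finset.univ :=
      Finset.eq_univ_of_card _ hcard
    have hi' : i ∈ insert (piv ⟨e, he⟩) img := by rw [huniv]; exact Finset.mem_univ i
    rw [Finset.mem_insert] at hi'
    rcases hi' with hi' | hi'
    · exact absurd (hi'.trans hp.symm) hi
    · rw [himg, Finset.mem_image] at hi'
      obtain ⟨j, -, hj⟩ := hi'
      exact ⟨j, hj⟩
  refine ⟨p, fun α hα t => ?_⟩
  -- ### Step 4: freeze `Z` at `α`, prescribe the chosen positions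
  let Ψ₁ : AffSys V := Ψ ∪ Z.image (fun v => (Pi.single v (1 : ZMod 2), α v))
  have hα₁ : α ∈ Sol Ψ₁ := by
    show α ∈ Sol (Ψ ∪ _)
    rw [Sol_union]
    refine ⟨hα, ?_⟩
    intro q hq
    rw [Finset.mem_image] at hq
    obtain ⟨v, -, rfl⟩ := hq
    simp [single_dotProduct]
  have hspan₁ : spanS Ψ₁ = S₁ := by
    show spanS (Ψ ∪ _) = S ⊔ coordS Z
    rw [spanS_union, hSdef, ← span_singles]
    congr 1
    unfold spanS forms
    rw [Finset.image_image]
    rfl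
  have hli₁ : LinearIndependent (ZMod 2)
      (fun x => (spanS Ψ₁).mkQ (Pi.single (g x) (1 : ZMod 2))) :=
    linearIndependent_mkQ_congr hspan₁.symm _ hli'
  obtain ⟨β, hβ₁, hβval⟩ :=
    exists_sol_prescribe ⟨α, hα₁⟩ g (fun x => t x.1.1 (idx x)) hli₁
  have hβ₁' : β ∈ Sol Ψ ∧ β ∈ Sol (Z.image (fun v => (Pi.single v (1 : ZMod 2), α v))) := by
    have : β ∈ Sol (Ψ ∪ _) := hβ₁
    rwa [Sol_union] at this
  refine ⟨β, hβ₁'.1, ?_, ?_⟩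
  · -- agreement with `α` off the outside blocks
    intro v hv
    have hvZ : v ∈ Z := by
      rw [hZ, Finset.mem_sdiff, hmemU]
      refine ⟨Finset.mem_univ v, ?_⟩
      rintro ⟨e, he, i, hbe⟩
      rw [hOdef, Finset.mem_sdiff] at he
      exact hv e he.2 i hbe
    have := hβ₁'.2 (Pi.single v (1 : ZMod 2), α v) (Finset.mem_image.mpr ⟨v, hvZ, rfl⟩)
    simpa [single_dotProduct] using this
  · -- the prescribed values at the non-pivot positions
    intro e he i hi
    have heO : e ∈ O := by rw [hOdef, Finset.mem_sdiff]; exact ⟨Finset.mem_univ e, he⟩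
    obtain ⟨j, hj⟩ := hcover e heO i hi
    have := hβval (⟨e, heO⟩, j)
    simp only [g] at this
    rw [hj] at this
    exact this

end AffSys

end Literature.Computability.MetaComplexity
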